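import Literature.AlgebraicGeometry.ShimuraVarieties.UnitaryBallLocalBiholomorphy
import Literature.NumberTheory.Transcendental.AnalytificationMorphisms
import HarnessLib

/-!
# Hecke translations between compact ball quotients are holomorphic, hence morphisms of the models

The TWISTED companion of `UnitaryBallLevelCovering` (level coverings `Γ₁\𝔹² → Γ₂\𝔹²`, `[v] ↦ [v]`).
Let `D₁ : UnitaryBallUniformisationDatum 2 X₁`, `D₂ : UnitaryBallUniformisationDatum 2 X₂` be ball
uniformizations `Γ₁\𝔹(V₁) ≅ X₁(ℂ)`, `Γ₂\𝔹(V₂) ≅ X₂(ℂ)` of smooth projective surfaces, and let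
`g ∈ GL₃(ℂ)` be an ISOMETRY of the complex hermitian spaces, `gᴴ · H₂^{τ₁} · g = H₁^{τ₁}` (so `v ↦ g v`
maps the negative cone of `V₁` into that of `V₂`, i.e. the ball onto the ball), which CONJUGATES THE GROUPS
INTO EACH OTHER: `g · Γ₁^{τ₁} · g⁻¹ ≤ Γ₂^{τ₁}` in `GL₃(ℂ)`.  The case of record: one hermitian space
(`D₁.Hℂ = D₂.Hℂ`), `g = γ^{τ₁}` for a RATIONAL isometry `γ ∈ U(V)(F)` (`map_τ₁_mem_realPoints`), and
`Γ₁ ≤ Γ₂ ∩ γ⁻¹Γ₂γ` a congruence subgroup of finite index (the Hecke level of `γ`; Shimura 1971 §3.1,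
§7.2–7.3) — then `[v] ↦ [γ v]` is the second projection `π_γ : Γ₁\𝔹² → Γ₂\𝔹²` of the HECKE
CORRESPONDENCE `T_γ = π_* ∘ π_γ^*` (the first, `π = [v] ↦ [v]`, is the level covering, `g = 1`).  We prove:

* `mulVec_mem_cone` — `g` maps `D₁.cone` into `D₂.cone`;
* `unif_mulVec_eq_of_unif_eq` — `v ↦ unif₂ (g v)` is constant on the fibres of `unif₁` (the fibres are the
  `Γ₁·ℂˣ`-orbits, and `g γ g⁻¹ ∈ Γ₂^{τ₁}` for `γ ∈ Γ₁^{τ₁}`), so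
* `exists_map_unif_mulVec_eq` — there is a map `f : X₁(ℂ) → X₂(ℂ)` with `f (unif₁ v) = unif₂ (g v)` on the
  cone: the HECKE TRANSLATION on complex points;
* `mdifferentiable_of_map_unif_mulVec_eq` — ANY map `f : X₁(ℂ) → X₂(ℂ)` with `f (unif₁ v) = unif₂ (g v)`
  (only the isometry clause is needed here), read in Hodge models `A₁`, `A₂`, is HOLOMORPHIC: if `T` is a
  Sylvester frame of `D₂` then `g⁻¹ T` is one of `D₁` (`conjTranspose_mul_mul_of_frame`), and for the ball
  uniformizations `ψ₁ = D₁.modelUnif A₁ ⟨g⁻¹T, _⟩`, `ψ₂ = D₂.modelUnif A₂ ⟨T, _⟩` one has `f ∘ ψ₁ = ψ₂`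
  (`g (g⁻¹ T) = T`); near any point `ψ₁` has a holomorphic local inverse in the chart
  (`UnitaryBallLocalBiholomorphy.ChartInverse`), so there `f = ψ₂ ∘ (local inverse) ∘ (chart)`, a composite
  of holomorphic maps (`unifHolomorphic`) — verbatim the argument of `UnitaryBallLevelCovering`;
* `exists_hom_map_unif_mulVec_eq` — under the record `Arapura2012_Cor_15_4_6` ("a holomorphic map between
  nonsingular projective algebraic varieties is a morphism", applied to the two analytifications), there is
  a morphism `f : X₁ ⟶ X₂` of `ℂ`-schemes with `f(ℂ) (unif₁ v) = unif₂ (g v)` on the cone: **the Hecke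
  translation is a morphism of the algebraic models**; `exists_hom_map_unif_mulVec_eq_of_mem_realPoints` is
  the same for one hermitian space and `g ∈ U(H^{τ₁})` (e.g. `g = γ^{τ₁}`, `γ ∈ U(V)(F)`).

All statements are theorems; the file declares no definitions (the record enters only as the hypothesis of
the last two theorems; it is a tree THEOREM, `arapura2012_cor_15_4_6_holds` of
`AnalytificationMorphismsProofs`, kept as a hypothesis so that this file stays on the light import cone of
its two imports — consumers discharge it by name).

References: G. Shimura, *Introduction to the arithmetic theory of automorphic functions* (1971), §3.1
(commensurators, double cosets `Γ α Γ`), Ch. 7 §7.2–7.3 (the correspondence attached to `Γ α Γ` and its two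
projections; algebraicity of modular correspondences); N. Bergeron, J. Millson, C. Moeglin, Acta Math. 216
(2016) = arXiv:1306.1515, Introduction §1.1 and Part 2 §1.8 (the tower of congruence ball quotients `S(Γ)`,
Hecke operators as algebraic correspondences); D. Arapura, *Algebraic Geometry over the Complex Numbers*
(2012), §15.4 Cor. 15.4.6; K. Fritzsche, H. Grauert, *From Holomorphic Functions to Complex Manifolds*
(2002), Ch. I §8 (local biholomorphisms).

## Provenance

Reproduction (Literature) for the Hodge-ladder cell pub-hodgecm2 (COR-CM, stage 2), seat b10 (gen 16): the
twisted form of the seat's own `UnitaryBallLevelCovering` (same proofs, with the frame transport `T ↦ g⁻¹T`),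
written as the geometric input «HeckeMor» named by the junction-B01 ideation memo
`HOME/b01/IDEA-1b-hecke-wedge-and-overlap.md` §2 step S2 (rational translates `P_{Γ∩γ⁻¹Γγ} → P_Γ`,
`[v] ↦ [γv]`, as elements of the model universe's `Mor`).  Every declaration is kernel-checked; no new records.
-/

noncomputable section

open Matrix Function Set Filter
open scoped Manifold Topology
open Literature.Geometry.ComplexHyperbolic
open Literature.Geometry.ComplexHyperbolic.BallModel (Ball)
open Literature.NumberTheory.Transcendental
open Literature.AlgebraicGeometry.HodgeTheory (HodgeModel)
open Literature.AlgebraicGeometry.Motives (SchemeOver ComplexPoints AlgPoints)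
open CategoryTheory

namespace Literature.AlgebraicGeometry.ShimuraVarieties.UnitaryBallHeckeTranslation

open Literature.AlgebraicGeometry.ShimuraVarieties UnitaryBallUniformisationDatum

variable {X₁ X₂ : SchemeOver ℂ} {D₁ : UnitaryBallUniformisationDatum 2 X₁} {D₂ : UnitaryBallUniformisationDatum 2 X₂}
  {g : GL (Fin 3) ℂ}

/-! ### The point-level translation `unif₁ v ↦ unif₂ (g v)` -/

/-- An isometry `g : (ℂ³, H₁^{τ₁}) → (ℂ³, H₂^{τ₁})`, `gᴴ H₂ g = H₁`, maps the negative cone of `V₁` into that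
of `V₂` (`⟪g v, g v⟫₂ = ⟪v, v⟫₁`). [cite: BergeronMillsonMoeglin2016Balls, Part 2 §1.3] -/
theorem mulVec_mem_cone (hg : (g : Matrix (Fin 3) (Fin 3) ℂ)ᴴ * D₂.Hℂ * (g : Matrix (Fin 3) (Fin 3) ℂ) = D₁.Hℂ)
    {v : Fin 3 → ℂ} (hv : v ∈ D₁.cone) : (g : Matrix (Fin 3) (Fin 3) ℂ) *ᵥ v ∈ D₂.cone := by
  rw [mem_negCone_iff, ConeChart.star_mulVec_dotProduct, hg]
  exact hv

/-- **`unif₂ (g v)` is constant on the fibres of `unif₁`** when `g` is an isometry conjugating `Γ₁^{τ₁}` into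
`Γ₂^{τ₁}`: the fibres of `unif₁` on the cone are the `Γ₁·ℂˣ`-orbits, and `γ v = c w` gives
`(g γ g⁻¹)(g v) = c (g w)` with `g γ g⁻¹ ∈ Γ₂^{τ₁}`.
[cite: Shimura1973, §7.2–7.3] [cite: BergeronMillsonMoeglin2016Balls, Introduction §1.1] -/
theorem unif_mulVec_eq_of_unif_eq
    (hg : (g : Matrix (Fin 3) (Fin 3) ℂ)ᴴ * D₂.Hℂ * (g : Matrix (Fin 3) (Fin 3) ℂ) = D₁.Hℂ)
    (hΓ : (D₁.Γ.map (Matrix.GeneralLinearGroup.map D₁.τ₁)).map (MulAut.conj g).toMonoidHom ≤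
      D₂.Γ.map (Matrix.GeneralLinearGroup.map D₂.τ₁))
    {v w : Fin 3 → ℂ} (hv : v ∈ D₁.cone) (hw : w ∈ D₁.cone) (h : D₁.unif v = D₁.unif w) :
    D₂.unif ((g : Matrix (Fin 3) (Fin 3) ℂ) *ᵥ v) = D₂.unif ((g : Matrix (Fin 3) (Fin 3) ℂ) *ᵥ w) := by
  obtain ⟨γ, hγ, c, hc, hγv⟩ := (D₁.unif_eq_unif_iff v hv w hw).1 h
  have hmem : (MulAut.conj g).toMonoidHom (Matrix.GeneralLinearGroup.map D₁.τ₁ γ) ∈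
      D₂.Γ.map (Matrix.GeneralLinearGroup.map D₂.τ₁) :=
    hΓ (Subgroup.mem_map_of_mem _ (Subgroup.mem_map_of_mem _ hγ))
  obtain ⟨γ₂, hγ₂, hγeq⟩ := Subgroup.mem_map.1 hmem
  refine (D₂.unif_eq_unif_iff _ (mulVec_mem_cone hg hv) _ (mulVec_mem_cone hg hw)).2 ⟨γ₂, hγ₂, c, hc, ?_⟩
  have hmat : ((γ₂ : GL (Fin 3) D₂.E) : Matrix (Fin 3) (Fin 3) D₂.E).map D₂.τ₁ =
      (g : Matrix (Fin 3) (Fin 3) ℂ) * ((γ : GL (Fin 3) D₁.E) : Matrix (Fin 3) (Fin 3) D₁.E).map D₁.τ₁ *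
        ((g⁻¹ : GL (Fin 3) ℂ) : Matrix (Fin 3) (Fin 3) ℂ) := by
    have hm := congrArg (fun x : GL (Fin 3) ℂ ↦ (x : Matrix (Fin 3) (Fin 3) ℂ)) hγeq
    simpa only [coe_generalLinearGroup_map, MulEquiv.coe_toMonoidHom, MulAut.conj_apply, Units.val_mul]
      using hm
  rw [hmat, mulVec_mulVec, Matrix.mul_assoc _ ((g⁻¹ : GL (Fin 3) ℂ) : Matrix (Fin 3) (Fin 3) ℂ)
      (g : Matrix (Fin 3) (Fin 3) ℂ), Units.inv_mul, Matrix.mul_one, ← mulVec_mulVec, hγv, mulVec_smul]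

/-- **The Hecke translation on complex points** exists: a map `f : X₁(ℂ) → X₂(ℂ)` with
`f (unif₁ v) = unif₂ (g v)` on the cone (`P ↦ unif₂ (g · (any cone vector over P))`; `unif₁` is onto, field
`surjOn_unif`, and `unif₂ ∘ g` is constant on its fibres, `unif_mulVec_eq_of_unif_eq`).
[cite: Shimura1973, §7.2–7.3] [cite: BergeronMillsonMoeglin2016Balls, Introduction §1.1] -/
theorem exists_map_unif_mulVec_eq
    (hg : (g : Matrix (Fin 3) (Fin 3) ℂ)ᴴ * D₂.Hℂ * (g : Matrix (Fin 3) (Fin 3) ℂ) = D₁.Hℂ)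
    (hΓ : (D₁.Γ.map (Matrix.GeneralLinearGroup.map D₁.τ₁)).map (MulAut.conj g).toMonoidHom ≤
      D₂.Γ.map (Matrix.GeneralLinearGroup.map D₂.τ₁)) :
    ∃ f : ComplexPoints X₁ → ComplexPoints X₂,
      ∀ v ∈ D₁.cone, f (D₁.unif v) = D₂.unif ((g : Matrix (Fin 3) (Fin 3) ℂ) *ᵥ v) := by
  have hsec : ∀ P : ComplexPoints X₁, ∃ v ∈ D₁.cone, D₁.unif v = P :=
    fun P ↦ D₁.surjOn_unif (mem_univ P)
  choose s hs hsP using hsec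
  exact ⟨fun P ↦ D₂.unif ((g : Matrix (Fin 3) (Fin 3) ℂ) *ᵥ s P),
    fun v hv ↦ unif_mulVec_eq_of_unif_eq hg hΓ (hs _) hv (hsP _)⟩

/-! ### The translation read in Hodge models is holomorphic -/

/-- **Frame transport**: if `T` is a Sylvester frame of `H₂^{τ₁}` (`Tᴴ H₂ T = J`) and `gᴴ H₂ g = H₁`, then
`g⁻¹ T` is a Sylvester frame of `H₁^{τ₁}`: `(g⁻¹T)ᴴ H₁ (g⁻¹T) = (g g⁻¹ T)ᴴ H₂ (g g⁻¹ T) = Tᴴ H₂ T = J`.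
[cite: BergeronMillsonMoeglin2016Balls, Part 2 §1.1] -/
theorem conjTranspose_mul_mul_of_frame
    (hg : (g : Matrix (Fin 3) (Fin 3) ℂ)ᴴ * D₂.Hℂ * (g : Matrix (Fin 3) (Fin 3) ℂ) = D₁.Hℂ)
    (𝔣 : D₂.SylvesterFrame) :
    ((g⁻¹ * 𝔣.T : GL (Fin 3) ℂ) : Matrix (Fin 3) (Fin 3) ℂ)ᴴ * D₁.Hℂ *
      ((g⁻¹ * 𝔣.T : GL (Fin 3) ℂ) : Matrix (Fin 3) (Fin 3) ℂ) = BallModel.J := by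
  have hS : (g : Matrix (Fin 3) (Fin 3) ℂ) * ((g⁻¹ * 𝔣.T : GL (Fin 3) ℂ) : Matrix (Fin 3) (Fin 3) ℂ) = 𝔣.t := by
    rw [← Units.val_mul, mul_inv_cancel_left]
  calc ((g⁻¹ * 𝔣.T : GL (Fin 3) ℂ) : Matrix (Fin 3) (Fin 3) ℂ)ᴴ * D₁.Hℂ *
        ((g⁻¹ * 𝔣.T : GL (Fin 3) ℂ) : Matrix (Fin 3) (Fin 3) ℂ)
      = ((g⁻¹ * 𝔣.T : GL (Fin 3) ℂ) : Matrix (Fin 3) (Fin 3) ℂ)ᴴ *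
          ((g : Matrix (Fin 3) (Fin 3) ℂ)ᴴ * D₂.Hℂ * (g : Matrix (Fin 3) (Fin 3) ℂ)) *
          ((g⁻¹ * 𝔣.T : GL (Fin 3) ℂ) : Matrix (Fin 3) (Fin 3) ℂ) := by rw [hg]
    _ = ((g : Matrix (Fin 3) (Fin 3) ℂ) * ((g⁻¹ * 𝔣.T : GL (Fin 3) ℂ) : Matrix (Fin 3) (Fin 3) ℂ))ᴴ * D₂.Hℂ *
          ((g : Matrix (Fin 3) (Fin 3) ℂ) * ((g⁻¹ * 𝔣.T : GL (Fin 3) ℂ) : Matrix (Fin 3) (Fin 3) ℂ)) := by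
        rw [conjTranspose_mul]; simp only [Matrix.mul_assoc]
    _ = BallModel.J := by rw [hS]; exact 𝔣.conjTranspose_mul_mul

/-- **Any map intertwining `unif₁` with `unif₂ ∘ g` is holomorphic** (read in Hodge models `A₁`, `A₂`, i.e.
conjugated by the homeomorphisms `Xᵢ^an ≃ₜ Xᵢ(ℂ)`).  With `T` a Sylvester frame of `D₂` and `g⁻¹T` the
transported frame of `D₁` (`conjTranspose_mul_mul_of_frame`), the uniformizations `ψ₁ = D₁.modelUnif A₁ ⟨g⁻¹T, _⟩`,
`ψ₂ = D₂.modelUnif A₂ ⟨T, _⟩` on the ball satisfy `f ∘ ψ₁ = ψ₂` (`g (g⁻¹T) = T`); near `x = ψ₁ z`, with `h` a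
holomorphic local inverse of `ψ₁` in the chart `c` at `x` (`ChartInverse`: `c⁻¹ = ψ₁ ∘ h`), `f = ψ₂ ∘ h ∘ c`, a
composite of holomorphic maps.
[cite: FritzscheGrauert2002, Ch. I §8 Cor. 8.6] [cite: Shimura1973, §7.2–7.3] [cite: SerreGAGA1956, §2] -/
theorem mdifferentiable_of_map_unif_mulVec_eq
    (hg : (g : Matrix (Fin 3) (Fin 3) ℂ)ᴴ * D₂.Hℂ * (g : Matrix (Fin 3) (Fin 3) ℂ) = D₁.Hℂ)
    {f : ComplexPoints X₁ → ComplexPoints X₂}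
    (hf : ∀ v ∈ D₁.cone, f (D₁.unif v) = D₂.unif ((g : Matrix (Fin 3) (Fin 3) ℂ) *ᵥ v))
    (A₁ : HodgeModel 2 X₁) (A₂ : HodgeModel 2 X₂) :
    MDifferentiable 𝓘(ℂ, A₁.model) 𝓘(ℂ, A₂.model)
      (fun x ↦ A₂.isAnalytification.homeomorph.symm (f (A₁.toComplexPoints x))) := by
  obtain ⟨𝔣⟩ := D₂.nonempty_sylvesterFrame
  -- the transported frame `g⁻¹ T` of `D₁`
  set 𝔣₁ : D₁.SylvesterFrame := ⟨g⁻¹ * 𝔣.T, conjTranspose_mul_mul_of_frame hg 𝔣⟩ with h𝔣₁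
  have hS : (g : Matrix (Fin 3) (Fin 3) ℂ) * ((g⁻¹ * 𝔣.T : GL (Fin 3) ℂ) : Matrix (Fin 3) (Fin 3) ℂ) = 𝔣.t := by
    rw [← Units.val_mul, mul_inv_cancel_left]
  set Φ : A₁.carrier → A₂.carrier :=
    fun x ↦ A₂.isAnalytification.homeomorph.symm (f (A₁.toComplexPoints x)) with hΦ
  -- `Φ ∘ ψ₁ = ψ₂` on the ball
  have hΦψ : ∀ z : Ball, Φ (D₁.modelUnif A₁ 𝔣₁ z.1) = D₂.modelUnif A₂ 𝔣 z.1 := by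
    intro z
    rw [hΦ]
    dsimp only
    rw [toComplexPoints_modelUnif, ballUnifMap_apply, hf _ (D₁.coneLift _ z).2]
    change A₂.isAnalytification.homeomorph.symm (D₂.unif ((g : Matrix (Fin 3) (Fin 3) ℂ) *ᵥ
      (((g⁻¹ * 𝔣.T : GL (Fin 3) ℂ) : Matrix (Fin 3) (Fin 3) ℂ) *ᵥ BallModel.lift z))) = _
    rw [mulVec_mulVec, hS]
    rfl
  intro x
  obtain ⟨z, hz⟩ := D₁.exists_modelUnif_eq A₁ 𝔣₁ x
  obtain ⟨c⟩ := D₁.nonempty_chartInverse A₁ 𝔣₁ z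
  set φ := extChartAt 𝓘(ℂ, A₁.model) x with hφ
  have hcenter : φ x ∈ c.W := by
    rw [hφ, ← hz]
    exact c.center_mem
  -- `Φ = ψ₂ ∘ h ∘ φ` near `x`
  have key : Φ =ᶠ[𝓝 x] fun x' ↦ D₂.modelUnif A₂ 𝔣 (c.g (φ x')) := by
    have h1 : ∀ᶠ x' in 𝓝 x, x' ∈ (chartAt A₁.model x).source :=
      (chartAt A₁.model x).open_source.mem_nhds (mem_chart_source _ x)
    have h2 : ∀ᶠ x' in 𝓝 x, φ x' ∈ c.W :=
      (continuousAt_extChartAt (I := 𝓘(ℂ, A₁.model)) x).eventually (c.isOpen.mem_nhds hcenter)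
    filter_upwards [h1, h2] with x' hx₁ hx₂
    have hsrc : x' ∈ φ.source := by rwa [hφ, extChartAt_source]
    have hx' : x' = D₁.modelUnif A₁ 𝔣₁ (c.g (φ x')) := by
      rw [← c.symm_eq (φ x') hx₂, hz]
      exact (φ.left_inv hsrc).symm
    have hball : c.g (φ x') ∈ BallForms.ballSet := c.mapsTo hx₂
    calc Φ x'
        = Φ (D₁.modelUnif A₁ 𝔣₁ (⟨c.g (φ x'), hball⟩ : Ball).1) := congrArg Φ hx'
      _ = D₂.modelUnif A₂ 𝔣 (⟨c.g (φ x'), hball⟩ : Ball).1 := hΦψ _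
  refine MDifferentiableAt.congr_of_eventuallyEq ?_ key
  have hφd : MDifferentiableAt 𝓘(ℂ, A₁.model) 𝓘(ℂ, A₁.model) φ x :=
    mdifferentiableAt_extChartAt (mem_chart_source _ x)
  have hcg : MDifferentiableAt 𝓘(ℂ, A₁.model) 𝓘(ℂ, Fin 2 → ℂ) c.g (φ x) :=
    mdifferentiableAt_iff_differentiableAt.2 (c.differentiableAt hcenter)
  have hψ : MDifferentiableAt 𝓘(ℂ, Fin 2 → ℂ) 𝓘(ℂ, A₂.model) (D₂.modelUnif A₂ 𝔣) (c.g (φ x)) :=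
    (D₂.unifHolomorphic A₂ 𝔣).mdifferentiableAt
      (BallForms.isOpen_ballSet.mem_nhds (c.mapsTo hcenter))
  have hcomp : MDifferentiableAt 𝓘(ℂ, A₁.model) 𝓘(ℂ, A₂.model)
      (D₂.modelUnif A₂ 𝔣 ∘ (c.g ∘ φ)) x :=
    hψ.comp x (hcg.comp x hφd)
  exact hcomp

/-! ### Algebraicity: the Hecke translation is a morphism of the models -/

/-- **The Hecke translation is a morphism of the algebraic models** (under the record
`Arapura2012_Cor_15_4_6`: a holomorphic map between nonsingular projective varieties is a morphism):
for an isometry `g`, `gᴴ H₂^{τ₁} g = H₁^{τ₁}`, with `g Γ₁^{τ₁} g⁻¹ ≤ Γ₂^{τ₁}`, there is `f : X₁ ⟶ X₂` over `ℂ`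
with `f(ℂ) (unif₁ v) = unif₂ (g v)` on the cone. The Hodge models `A₁`, `A₂` (analytifications) are inputs;
the conclusion does not mention them. [cite: Arapura2012, §15.4 Cor. 15.4.6] [cite: Shimura1973, §7.2–7.3]
[cite: BergeronMillsonMoeglin2016Balls, Part 2 §1.8] -/
theorem exists_hom_map_unif_mulVec_eq (hA : Arapura2012_Cor_15_4_6)
    (hg : (g : Matrix (Fin 3) (Fin 3) ℂ)ᴴ * D₂.Hℂ * (g : Matrix (Fin 3) (Fin 3) ℂ) = D₁.Hℂ)
    (hΓ : (D₁.Γ.map (Matrix.GeneralLinearGroup.map D₁.τ₁)).map (MulAut.conj g).toMonoidHom ≤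
      D₂.Γ.map (Matrix.GeneralLinearGroup.map D₂.τ₁))
    (A₁ : HodgeModel 2 X₁) (A₂ : HodgeModel 2 X₂) :
    ∃ f : X₁ ⟶ X₂, ∀ v ∈ D₁.cone,
      AlgPoints.map f (D₁.unif v) = D₂.unif ((g : Matrix (Fin 3) (Fin 3) ℂ) *ᵥ v) := by
  obtain ⟨f, hf⟩ := exists_map_unif_mulVec_eq hg hΓ
  obtain ⟨φ, hφ⟩ := hA X₁ X₂ D₁.isSmoothProjective D₂.isSmoothProjective A₁.model A₁.carrier
    A₁.toComplexPoints A₁.isAnalytification A₂.model A₂.carrier A₂.toComplexPoints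
    A₂.isAnalytification _ (mdifferentiable_of_map_unif_mulVec_eq hg hf A₁ A₂)
  refine ⟨φ, fun v hv ↦ ?_⟩
  have h := hφ (A₁.isAnalytification.homeomorph.symm (D₁.unif v))
  have h₁ : A₁.toComplexPoints (A₁.isAnalytification.homeomorph.symm (D₁.unif v)) = D₁.unif v :=
    A₁.isAnalytification.homeomorph.apply_symm_apply _
  have h₂ : A₂.toComplexPoints (A₂.isAnalytification.homeomorph.symm (f (D₁.unif v))) = f (D₁.unif v) :=
    A₂.isAnalytification.homeomorph.apply_symm_apply _
  rw [h₁, h₂, hf v hv] at h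
  exact h.symm

/-- The same with the analytifications supplied by any existence statement for Hodge models (e.g. the tree's
`BettiUniverse.realHodgeModel hHD`). [cite: Arapura2012, §15.4 Cor. 15.4.6] [cite: Shimura1973, §7.2–7.3] -/
theorem exists_hom_map_unif_mulVec_eq_of_nonempty (hA : Arapura2012_Cor_15_4_6)
    (hA₁ : Nonempty (HodgeModel 2 X₁)) (hA₂ : Nonempty (HodgeModel 2 X₂))
    (hg : (g : Matrix (Fin 3) (Fin 3) ℂ)ᴴ * D₂.Hℂ * (g : Matrix (Fin 3) (Fin 3) ℂ) = D₁.Hℂ)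
    (hΓ : (D₁.Γ.map (Matrix.GeneralLinearGroup.map D₁.τ₁)).map (MulAut.conj g).toMonoidHom ≤
      D₂.Γ.map (Matrix.GeneralLinearGroup.map D₂.τ₁)) :
    ∃ f : X₁ ⟶ X₂, ∀ v ∈ D₁.cone,
      AlgPoints.map f (D₁.unif v) = D₂.unif ((g : Matrix (Fin 3) (Fin 3) ℂ) *ᵥ v) :=
  let ⟨A₁⟩ := hA₁; let ⟨A₂⟩ := hA₂; exists_hom_map_unif_mulVec_eq hA hg hΓ A₁ A₂

/-- **One hermitian space, `g ∈ U(H^{τ₁})`** (the case of record: `D₁.Hℂ = D₂.Hℂ` and `g = γ^{τ₁}` for a rational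
isometry `γ ∈ U(V)(F)`, `map_τ₁_mem_realPoints`, with `Γ₁ ≤ γ⁻¹Γ₂γ`): the Hecke translation `[v] ↦ [g v]` is a
morphism `f : X₁ ⟶ X₂` with `f(ℂ) (unif₁ v) = unif₂ (g v)` on the cone.
[cite: Arapura2012, §15.4 Cor. 15.4.6] [cite: Shimura1973, §7.2–7.3] [cite: BergeronMillsonMoeglin2016Balls, Part 2 §1.8] -/
theorem exists_hom_map_unif_mulVec_eq_of_mem_realPoints (hA : Arapura2012_Cor_15_4_6)
    (hA₁ : Nonempty (HodgeModel 2 X₁)) (hA₂ : Nonempty (HodgeModel 2 X₂)) (hH : D₁.Hℂ = D₂.Hℂ)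
    (hg : g ∈ D₂.realPoints)
    (hΓ : (D₁.Γ.map (Matrix.GeneralLinearGroup.map D₁.τ₁)).map (MulAut.conj g).toMonoidHom ≤
      D₂.Γ.map (Matrix.GeneralLinearGroup.map D₂.τ₁)) :
    ∃ f : X₁ ⟶ X₂, ∀ v ∈ D₁.cone,
      AlgPoints.map f (D₁.unif v) = D₂.unif ((g : Matrix (Fin 3) (Fin 3) ℂ) *ᵥ v) :=
  exists_hom_map_unif_mulVec_eq_of_nonempty hA hA₁ hA₂
    ((ConeChart.mem_unitaryGroup_conj_iff.mp hg).trans hH.symm) hΓ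

end Literature.AlgebraicGeometry.ShimuraVarieties.UnitaryBallHeckeTranslation

end
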